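import Summits.HodgeConjecture.HodgeConjecture.Theorems.F0P6aKillEngineWSpecialW
import Summits.HodgeConjecture.HodgeConjecture.Theorems.F0P6aKillEngineKillEngine
import HarnessLib

/-!
# `F0P6aKillEngineW` — ★ RE-HOME of `Lines/F0_P6a_KillEngineW.lean` (tree sha16 9e31b9f7f48926b4), PART 3 of 3 — tree lines :699–:992 (LAST part: the module the `Lines/` shim and consumers import; it transitively carries parts 1–2).

See PART 1 `Theorems/F0P6aKillEngineWLayerW.lean` for the full ★ re-home header and the original module docstring (verbatim there).  Same namespace (every fully-qualified name unchanged);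
the scopes open at the cut (`noncomputable section` ∕ `namespace` ∕ `section`s) are re-opened below with their `variable` ∕ `open` ∕ `set_option` ∕ `omit` ∕ `include` ∕ `universe` lines
replayed verbatim from the tree, in order; the code after the replay block is the tree bytes :699–:992, untouched.  HC_CM is proved only modulo the 7 printed citations (2 remaining: hLiu418 = stmt-HodgeConjecture-24832, h413 = stmt-HodgeConjecture-24833) until rung 0 closes; a re-home is count-neutral.
-/

-- ── replay of the scopes open at tree line :699 (verbatim) ──
set_option autoImplicit false
set_option linter.dupNamespace false
noncomputable section
namespace Summit.HodgeConjecture.HodgeConjecture.Cruxes.HLiu418.F0P6aLineSpecialisation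
open CategoryTheory CategoryTheory.Limits NumberField IsDedekindDomain MulAction AlgebraicGeometry
open scoped Matrix Polynomial Pointwise MonoidalCategory
open Literature.NumberTheory.GaloisRepresentations
open Literature.NumberTheory.Automorphic Literature.NumberTheory.Automorphic.UnitaryGroup
open Literature.AlgebraicGeometry.ShimuraVarieties.UnitaryCanonicalModel
open Literature.NumberTheory.Automorphic.Liu2021.AppendixC
open Literature.AlgebraicGeometry.Motives (AlgPoints IntegralModel SchemeOver thickening thickeningGalAction thickeningLift specOver extendPoint
  specValuationSubring specFractionFieldι specRingHomι)
open Literature.NumberTheory.DiophantineGeometry (geomResidueField specialFibreFunctor specResidueField geomClosedPointIsoSpecResidueField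
  geomResidueFieldEquiv toClosureValuationSubring)
open Literature.AlgebraicGeometry.RelativeSpec (ActionOver)
open Literature.NumberTheory.EllipticCurves (genericFibre specGenericPoint)
open Literature.AlgebraicGeometry.AbelianSchemes Literature.AlgebraicGeometry.AbelianSchemes.AbelianSchemeOver
open Literature.AlgebraicGeometry.GroupSchemes.AffineGroupScheme (Alg)
open Summit.HodgeConjecture.HodgeConjecture.Cruxes.HLiu418.F0P6aModuliDatumDefs
open Summit.HodgeConjecture.HodgeConjecture.Cruxes.HLiu418.F0P6aRGDAssembly
open Summit.HodgeConjecture.HodgeConjecture.Cruxes.HLiu418.F0P6aDatumOfInputs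
section KillEngineW
set_option synthInstance.maxHeartbeats 100000
open Literature.AlgebraicGeometry.GroupSchemes (GroupSchemeKernel.ker GroupSchemeKernel.kerι GroupSchemeKernel.kerLift GroupSchemeKernel.kerLift_ι
  GroupSchemeKernel.kerι_comp GroupSchemeKernel.isClosedImmersion_kerι_left_of_isSeparated)
open Literature.AlgebraicGeometry.GroupSchemes.AffineGroupScheme (quotIncl ptEquiv spI exists_comp_quotIncl_eq_of_le_ker exists_hom_comp_eq_quotIncl_of_forall
  ptEquiv_quotIncl pullback_map_quotIncl_sat_comp_eq_one quotIncl_spI_comp_eq_one_of_pullback_map flat_specOver_quotient_sat_hom algBaseChangeEquiv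
  isClosedImmersion_quotIncl_left)
variable {F : Type} [Field F] [NumberField F] [IsCMField F] {ι₁ : F →+* ℂ}
    {Jstar : Matrix (Fin 2) (Fin 2) F}
    {K₀ : C5.OpenCompactSubgroup ↥(finAdelic ↥(maximalRealSubfield F) F (IsCMField.complexConj F) 2 Jstar)}
    {S : RecordSystemGS F Jstar ι₁ K₀} {hU7ₛ : S.HeckeTranslateDefinedOver}
    {hJ : (Jstar.map (IsCMField.complexConj F))ᵀ = Jstar} {hJu : IsUnit Jstar}
    {Fi : Type} [Field Fi] [Algebra F Fi] {Kc : C5.SmallLevel K₀} {G : Type} [Group G]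
    {𝓜 : IntegralModel (𝓞 F) F ((thickening F Fi).obj (S.M.obj Kc))}
    {w : HeightOneSpectrum (𝓞 F)} {hw : (IsCMField.complexConj F) • w ≠ w} {h𝓨 : (𝓜.localise w).IsSmoothProper 1}
    {θ : ActionOver (𝓜.localise w).total.hom ((Fi ≃ₐ[F] Fi) × G)}
    {e : Fi →ₐ[F] AlgebraicClosure (w.adicCompletion F)}
variable (I : RGDInputsAt F ι₁ Jstar K₀ S hU7ₛ hJ hJu Fi Kc G 𝓜 w hw h𝓨 θ e)
-- ── tree bytes :699–:992 ──

/-! ### §W1 the generic upstairs kill for a `w`-line INSIDE the roof kernel -/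

set_option maxHeartbeats 400000 in
open scoped MonObj in
set_option backward.isDefEq.respectTransparency false in
/-- **THE GENERIC KILL (W)**: `V(eLW Hw) ↪ layerΩW I y → A_y —q→ B` is trivial as soon as `q` kills the points of `Hw` (`Hw ⊆ K = Ker q(Ω̄)`, (r1)) — KillEngine §1 with
`layerΩ ↦ layerΩW`, `eLOf ↦ eLWOf`, the line hypothesis replaced by `hHK : Hw ⊆ K`. [cite: Tate1997FiniteFlatGroupSchemes, (3.7)] [cite: StacksProject, Tag 00U3]
[cite: Liu2021, Prop. D.8 (2) p. 135] -/
theorem quotIncl_eLWOf_comp_eq_one (y : AlgPoints (S.M.obj Kc) (AlgebraicClosure (w.adicCompletion F))) (Hw : LineWOf I y)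
    {B : AbelianSchemeOver (Spec (.of (AlgebraicClosure (w.adicCompletion F))))} (q : (schΩOf S Kc 𝓜 w e I.univ y).X ⟶ B.X) [IsMonHom q]
    (K : Subgroup ((fibreΩOf S Kc 𝓜 w e I.univ y).Points (AlgebraicClosure (w.adicCompletion F))))
    (hHK : ∀ P ∈ Hw.1, P ∈ K)
    (r1 : ∀ P : (fibreΩOf S Kc 𝓜 w e I.univ y).Points (AlgebraicClosure (w.adicCompletion F)),
      (AlgPoints.map q P : B.toAffine.toAbelianVariety.Points (AlgebraicClosure (w.adicCompletion F))) = 1 ↔ P ∈ K) :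
    haveI := isMonHom_transRW I y
    haveI := isAffine_layerΩW_left I y
    quotIncl (layerΩW I y) (eLWOf I y Hw).1 ≫ ((Over.pullback (sΩ w)).map (ιRW I y) ≫ (isoGenericOf I y).inv ≫ q) = 1 := by
  haveI := isMonHom_transRW I y
  haveI := isAffine_layerΩW_left I y
  haveI := etale_layerΩW_hom I y
  haveI := B.isProper
  haveI : IsClosedImmersion (GroupSchemeKernel.kerι ((Over.pullback (sΩ w)).map (ιRW I y) ≫ (isoGenericOf I y).inv ≫ q)).left :=
    GroupSchemeKernel.isClosedImmersion_kerι_left_of_isSeparated _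
  haveI : IsAffine (GroupSchemeKernel.ker ((Over.pullback (sΩ w)).map (ιRW I y) ≫ (isoGenericOf I y).inv ≫ q)).left :=
    isAffine_of_isAffineHom (GroupSchemeKernel.kerι ((Over.pullback (sΩ w)).map (ιRW I y) ≫ (isoGenericOf I y).inv ≫ q)).left
  have hu : ∀ i : {x : specOver (AlgebraicClosure (w.adicCompletion F)) (AlgebraicClosure (w.adicCompletion F)) ⟶ layerΩW I y //
        (eLWOf I y Hw).1 ≤ RingHom.ker (ptEquiv (layerΩW I y) (AlgebraicClosure (w.adicCompletion F)) x).toRingHom},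
      ∃ v : specOver (AlgebraicClosure (w.adicCompletion F)) (AlgebraicClosure (w.adicCompletion F)) ⟶
          GroupSchemeKernel.ker ((Over.pullback (sΩ w)).map (ιRW I y) ≫ (isoGenericOf I y).inv ≫ q),
        v ≫ GroupSchemeKernel.kerι ((Over.pullback (sΩ w)).map (ιRW I y) ≫ (isoGenericOf I y).inv ≫ q) = i.1 := by
    intro i
    have hmem := (eLWOf_le_ker_iff I y Hw i.1).1 i.2
    have hq1 : i.1 ≫ ((Over.pullback (sΩ w)).map (ιRW I y) ≫ (isoGenericOf I y).inv ≫ q) = 1 := by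
      have h := (r1 _).2 (hHK _ hmem)
      simpa only [AlgPoints.map, Category.assoc] using h
    exact ⟨GroupSchemeKernel.kerLift i.1 hq1, GroupSchemeKernel.kerLift_ι _ _⟩
  obtain ⟨vv, hvv, -⟩ := exists_hom_comp_eq_quotIncl_of_forall
    (GroupSchemeKernel.kerι ((Over.pullback (sΩ w)).map (ιRW I y) ≫ (isoGenericOf I y).inv ≫ q))
    (fun i : {x : specOver (AlgebraicClosure (w.adicCompletion F)) (AlgebraicClosure (w.adicCompletion F)) ⟶ layerΩW I y //
        (eLWOf I y Hw).1 ≤ RingHom.ker (ptEquiv (layerΩW I y) (AlgebraicClosure (w.adicCompletion F)) x).toRingHom} => i.1) hu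
  have hJ := Literature.AlgebraicGeometry.GroupSchemes.EtaleIdealPoints.eq_ker_pi_ptEquiv_points (layerΩW I y) (eLWOf I y Hw).1
  obtain ⟨z, hz⟩ := exists_comp_quotIncl_eq_of_le_ker (layerΩW I y)
    (RingHom.ker (AlgHom.pi fun i : {x : specOver (AlgebraicClosure (w.adicCompletion F)) (AlgebraicClosure (w.adicCompletion F)) ⟶ layerΩW I y //
        (eLWOf I y Hw).1 ≤ RingHom.ker (ptEquiv (layerΩW I y) (AlgebraicClosure (w.adicCompletion F)) x).toRingHom} =>
          ptEquiv (layerΩW I y) (AlgebraicClosure (w.adicCompletion F)) i.1).toRingHom)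
    (quotIncl (layerΩW I y) (eLWOf I y Hw).1) (by
      rw [ptEquiv_quotIncl]
      intro a ha
      rw [RingHom.mem_ker, AlgHom.toRingHom_eq_coe, AlgHom.coe_toRingHom, Ideal.Quotient.mkₐ_eq_mk, Ideal.Quotient.eq_zero_iff_mem]
      rw [hJ]
      exact ha)
  rw [← hz, Category.assoc, ← hvv, Category.assoc, GroupSchemeKernel.kerι_comp, MonObj.comp_one, MonObj.comp_one]

/-! ### §W1′ the generic kill read on the generic fibre of the flat closure -/

set_option maxHeartbeats 400000 in
open scoped MonObj in
set_option backward.isDefEq.respectTransparency false in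
/-- **THE GENERIC KILL ON THE CLOSURE (W)**: `V(J^sat)_η ↪ (layerRW)_η ↪ (famOf I y)_η —σΩ⁻¹→ A_y —q→ B` is trivial (§W1 + ★ p849577). [cite: EGAIV2, Prop. 2.8.5]
[cite: Liu2021, Prop. D.8 (2) p. 135] -/
theorem pullback_map_closureW_comp_eq_one (y : AlgPoints (S.M.obj Kc) (AlgebraicClosure (w.adicCompletion F))) (Hw : LineWOf I y)
    {B : AbelianSchemeOver (Spec (.of (AlgebraicClosure (w.adicCompletion F))))} (q : (schΩOf S Kc 𝓜 w e I.univ y).X ⟶ B.X) [IsMonHom q]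
    (K : Subgroup ((fibreΩOf S Kc 𝓜 w e I.univ y).Points (AlgebraicClosure (w.adicCompletion F))))
    (hHK : ∀ P ∈ Hw.1, P ∈ K)
    (r1 : ∀ P : (fibreΩOf S Kc 𝓜 w e I.univ y).Points (AlgebraicClosure (w.adicCompletion F)),
      (AlgPoints.map q P : B.toAffine.toAbelianVariety.Points (AlgebraicClosure (w.adicCompletion F))) = 1 ↔ P ∈ K) :
    haveI := isMonHom_transRW I y
    haveI := isAffine_layerRW_left I y
    (Over.pullback (sΩ w)).map (closureInclWOf I y Hw) ≫ (isoGenericOf I y).inv ≫ q = 1 := by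
  haveI := isMonHom_transRW I y
  haveI := isAffine_layerRW_left I y
  haveI := isAffine_layerΩW_left I y
  have hcore := quotIncl_eLWOf_comp_eq_one I y Hw q K hHK r1
  have hgen := pullback_map_quotIncl_sat_comp_eq_one (AlgebraicClosure (w.adicCompletion F)) (layerRW I y) (eLWOf I y Hw).1 (eLWOf I y Hw).2.1 _ hcore
  rw [Functor.map_comp, Category.assoc]
  exact hgen

/-! ### §W4 the MODEL special kill at `sκ w` through `σκ⁻¹` from the (K3-gen) row, and (CLw-2)'s kill by `q̄` on `V(spIW)` -/

set_option maxHeartbeats 400000 in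
open scoped MonObj CategoryTheory.Obj in
set_option backward.isDefEq.respectTransparency false in
/-- **THE MODEL SPECIAL KILL (W) FROM THE (K3-gen) ROW**: under the (F1) identifications, `V(J^sat)_{sκ} ↪ (layerRW)_{sκ} ↪ (famOf I y)_{sκ} —σκ⁻¹→ A_{red₀ y} —q̄→ M` is trivial
(§W1′ is the generic premiss modulo `hσΩ`; the row gives the kill at ★'s `s̄_R`; §W3 moves it to `sκ w`; `hσκ`). [cite: Liu2021, Prop. D.8 (2) p. 135, p. 137]
[cite: SerreTate1968, §1 Lemma 2] [cite: EGAIV2, Prop. 2.8.5] -/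
theorem pullback_map_closureW_inv_comp_eq_one_of_kerRow (y : AlgPoints (S.M.obj Kc) (AlgebraicClosure (w.adicCompletion F))) (Hw : LineWOf I y)
    {B : AbelianSchemeOver (Spec (.of (AlgebraicClosure (w.adicCompletion F))))} (q : (schΩOf S Kc 𝓜 w e I.univ y).X ⟶ B.X) [IsMonHom q]
    (K : Subgroup ((fibreΩOf S Kc 𝓜 w e I.univ y).Points (AlgebraicClosure (w.adicCompletion F))))
    (hHK : ∀ P ∈ Hw.1, P ∈ K)
    (r1 : ∀ P : (fibreΩOf S Kc 𝓜 w e I.univ y).Points (AlgebraicClosure (w.adicCompletion F)),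
      (AlgPoints.map q P : B.toAffine.toAbelianVariety.Points (AlgebraicClosure (w.adicCompletion F))) = 1 ↔ P ∈ K)
    {M : SchemeOver (geomResidueField w)} [MonObj M]
    (qbar : (sch₀Of 𝓜 w I.univ (red₀Of S Kc 𝓜 w h𝓨 e y)).X ⟶ M)
    (hσΩ : (isoGenericOf I y).inv =
      (I.univ.fibreBaseChangeIso ((𝓜.localise w).genericIso'.inv.left ≫ pullback.fst (𝓜.localise w).total.hom (specGenericPoint (HeightOneSpectrum.valuationSubringAtPrime F w) F))
          (thickeningLift e (S.M.obj Kc) y).left ≪≫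
        I.univ.fibreCongrPtIso (left_thickeningLift_comp_genericι_eq S Kc 𝓜 w h𝓨 e y) ≪≫
        (I.univ.fibreBaseChangeIso (liftOf S Kc 𝓜 w h𝓨 e y).left (sΩ w)).symm).inv.hom.hom.hom)
    (hσκ : (isoSpecialOf I y).inv =
      (I.univ.fibreBaseChangeIso (pullback.fst (𝓜.localise w).total.hom (specResidueField w)) (red₀Of S Kc 𝓜 w h𝓨 e y).left ≪≫
        I.univ.fibreCongrPtIso (left_red₀Of_comp_specialι_eq S Kc 𝓜 w h𝓨 e y) ≪≫
        (I.univ.fibreBaseChangeIso (liftOf S Kc 𝓜 w h𝓨 e y).left (sκ w)).symm).inv.hom.hom.hom)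
    (hK3 : haveI : IsProper (𝓜.localise w).total.hom := h𝓨.2
      ∀ (𝒦 : Over (Spec (.of (closureValuationSubring (w.adicCompletion F))))) (incl : 𝒦 ⟶ (I.univ.baseChange (extendPoint (closureValuationSubring (w.adicCompletion F)) (toClosureValuationSubring w) (𝓜.localise w).total ((𝓜.localise w).modelPointsEquiv.symm (thickeningLift e (S.M.obj Kc) y))).left).X) [Flat 𝒦.hom],
        ((Over.pullback (specFractionFieldι (closureValuationSubring (w.adicCompletion F)) (toClosureValuationSubring w)).left).map incl ≫
            (I.univ.fibreBaseChangeIso ((𝓜.localise w).genericIso'.inv.left ≫ pullback.fst (𝓜.localise w).total.hom (specGenericPoint (HeightOneSpectrum.valuationSubringAtPrime F w) F)) (thickeningLift e (S.M.obj Kc) y).left ≪≫ I.univ.fibreCongrPtIso ((𝓜.localise w).left_specFractionFieldι_comp_extendPoint_modelPointsEquiv_symm (thickeningLift e (S.M.obj Kc) y)).symm ≪≫ (I.univ.fibreBaseChangeIso (extendPoint (closureValuationSubring (w.adicCompletion F)) (toClosureValuationSubring w) (𝓜.localise w).total ((𝓜.localise w).modelPointsEquiv.symm (thickeningLift e (S.M.obj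 Kc) y))).left (specFractionFieldι (closureValuationSubring (w.adicCompletion F)) (toClosureValuationSubring w)).left).symm).inv.hom.hom.hom) ≫ q = 1 →
        ((Over.pullback ((geomClosedPointIsoSpecResidueField w).inv.left ≫ (specRingHomι (closureValuationSubring (w.adicCompletion F)) (toClosureValuationSubring w) (IsLocalRing.residue (closureValuationSubring (w.adicCompletion F)))).left)).map incl ≫
            (I.univ.fibreBaseChangeIso (pullback.fst (𝓜.localise w).total.hom (specResidueField w)) ((𝓜.localise w).geomReductionMap (thickeningLift e (S.M.obj Kc) y)).left ≪≫ I.univ.fibreCongrPtIso (((𝓜.localise w).left_geomReductionMap_comp_fst (thickeningLift e (S.M.obj Kc) y)).trans (Category.assoc _ _ _).symm) ≪≫ (I.univ.fibreBaseChangeIso (extendPoint (closureValuationSubring (w.adicCompletion F)) (toClosureValuationSubring w) (𝓜.localise w).total ((𝓜.localise w).modelPointsEquiv.symm (thickeningLift e (S.M.obj Kc) y))).left ((geomClosedPointIsoSpecResidueField w).inv.left ≫ (specRingHomι (closureValuationSubring (w.adicCompletion F)) (toClosureValuationSubring w) (IsLocalRing.residue (closureValuationSubring (w.adicCompletion F)))).left)).symm).inv.hom.hom.hom)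 ≫ qbar = 1) :
    haveI := isMonHom_transRW I y
    haveI := isAffine_layerRW_left I y
    (Over.pullback (sκ w)).map (closureInclWOf I y Hw) ≫ (isoSpecialOf I y).inv ≫ qbar = 1 := by
  letI := (toGeomκ w).toAlgebra
  haveI : IsProper (𝓜.localise w).total.hom := h𝓨.2
  haveI := isMonHom_transRW I y
  haveI := isAffine_layerRW_left I y
  haveI := isAffine_layerΩW_left I y
  have h1 := pullback_map_closureW_comp_eq_one I y Hw q K hHK r1
  rw [hσΩ] at h1
  haveI := flat_closureW_hom I y Hw
  have h3 := hK3 (specOver ↥(closureValuationSubring (w.adicCompletion F)) (Alg (layerRW I y) ⧸ satWOf I y Hw)) (closureInclWOf I y Hw)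
    (by rw [Category.assoc]; exact h1)
  have h4 := comp_threePiece_inv_comp_eq_one_of_eq (s₂ := sκ w) (pullback.fst (𝓜.localise w).total.hom (specResidueField w)) (red₀Of S Kc 𝓜 w h𝓨 e y).left
    (liftOf S Kc 𝓜 w h𝓨 e y).left I.univ (specMap_toGeomκ_eq w).symm
    (((𝓜.localise w).left_geomReductionMap_comp_fst (thickeningLift e (S.M.obj Kc) y)).trans (Category.assoc _ _ _).symm)
    (left_red₀Of_comp_specialι_eq S Kc 𝓜 w h𝓨 e y) (closureInclWOf I y Hw) qbar h3
  rw [← hσκ, Category.assoc] at h4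
  exact h4

set_option maxHeartbeats 400000 in
open scoped MonObj CategoryTheory.Obj in
set_option backward.isDefEq.respectTransparency false in
/-- **(CLw-2) BY `q̄`**: `V(spIW Hw) ↪ layerκW —(ιRW)_κ̄→ (famOf I y)_κ̄ —σκ⁻¹→ A_{red₀ y} —q̄→ M` is trivial (★ p849577 `quotIncl_spI_comp_eq_one_of_pullback_map` on §W4's model kill;
`spIWOf = spI … (eLW Hw)` by definition). [cite: EGAIV2, Prop. 2.8.5] [cite: Tate1997FiniteFlatGroupSchemes, (3.7)] -/
theorem quotIncl_spIWOf_comp_eq_one_of_pullback_map (y : AlgPoints (S.M.obj Kc) (AlgebraicClosure (w.adicCompletion F))) (Hw : LineWOf I y)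
    {M : SchemeOver (geomResidueField w)} [MonObj M]
    (ψ : (sch₀Of 𝓜 w I.univ (red₀Of S Kc 𝓜 w h𝓨 e y)).X ⟶ M)
    (hψ : haveI := isMonHom_transRW I y
      haveI := isAffine_layerRW_left I y
      (Over.pullback (sκ w)).map (closureInclWOf I y Hw) ≫ (isoSpecialOf I y).inv ≫ ψ = 1) :
    haveI := isMonHom_transRW I y
    haveI := isAffine_layerκW_left I y
    quotIncl (layerκW I y) (spIWOf I y Hw) ≫ ((Over.pullback (sκ w)).map (ιRW I y) ≫ (isoSpecialOf I y).inv ≫ ψ) = 1 := by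
  letI := (toGeomκ w).toAlgebra
  haveI := isMonHom_transRW I y
  haveI := isAffine_layerRW_left I y
  haveI := isAffine_layerκW_left I y
  haveI := isAffine_layerΩW_left I y
  have h : (Over.pullback (sκ w)).map (quotIncl (layerRW I y) (satWOf I y Hw)) ≫
      ((Over.pullback (sκ w)).map (ιRW I y) ≫ (isoSpecialOf I y).inv ≫ ψ) = 1 := by
    rw [← Category.assoc, ← Functor.map_comp]
    exact hψ
  exact quotIncl_spI_comp_eq_one_of_pullback_map (AlgebraicClosure (w.adicCompletion F)) (geomResidueField w) (layerRW I y) (eLWOf I y Hw).1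
    (eLWOf I y Hw).2.1 _ h

/-! ### §W5 HEAD-W: the `w`-SIDE WITNESS `hclw` -/

set_option maxHeartbeats 400000 in
open scoped MonObj CategoryTheory.Obj in
set_option backward.isDefEq.respectTransparency false in
/-- **(CL-w) THE `w`-SIDE WITNESS FROM THE (K3-gen) ROW — the `hclw` ∃-pack of LA3-p03 (g4) W7 §6a, VERBATIM at `x̄ := red₀Of … y`.**  Inputs: the roof leg `q` with (r1) and kernel
`K`, a `w`-line `Hw : LineWOf I y` inside `K` (`hHK`; §W6 packages `K ∩ A_y[𝔭_w]`), ANY `q̄ : A_{red₀ y} → B̄` satisfying the (K3-gen) row of ★ `…_kerRows` ((b′) text), and the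
(F1) identifications `hσΩ`∕`hσκ`.  WITNESS: `V := Spec (Γ(layerκW I y) ⧸ spIWOf Hw)`, `ν := quotIncl ≫ (ιRW)_κ̄ ≫ σκ⁻¹`: CLOSED (★ `isClosedImmersion_quotIncl_left`, §L′
`isClosedImmersion_pullback_map_ιRW_left`, iso); its points are `𝔭_w`-TORSION (§L′ `pullback_map_ιRW_comp_i_eq_one` ∘ `act₀_i_comp_isoSpecialOf_hom`) and `q̄`-KILLED (§W4);
RANK `p^f ≤ dim Γ(V)` (★ `FrobKillEt.finrank_alg_specOver_quotient` + §L′ `isAdm_spIWOf`, with equality). [cite: Liu2021, Appendix D, Prop. D.8 (3) (p. 137)]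
[cite: Tate1997FiniteFlatGroupSchemes, §(3.7) (p. 146)] [cite: EGAIV2, Prop. 2.8.5] [cite: SerreTate1968, §1 Lemma 2] -/
theorem exists_wWitness_of_kerRow (y : AlgPoints (S.M.obj Kc) (AlgebraicClosure (w.adicCompletion F))) (Hw : LineWOf I y)
    {B : AbelianSchemeOver (Spec (.of (AlgebraicClosure (w.adicCompletion F))))} (q : (schΩOf S Kc 𝓜 w e I.univ y).X ⟶ B.X) [IsMonHom q]
    (K : Subgroup ((fibreΩOf S Kc 𝓜 w e I.univ y).Points (AlgebraicClosure (w.adicCompletion F))))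
    (hHK : ∀ P ∈ Hw.1, P ∈ K)
    (r1 : ∀ P : (fibreΩOf S Kc 𝓜 w e I.univ y).Points (AlgebraicClosure (w.adicCompletion F)),
      (AlgPoints.map q P : B.toAffine.toAbelianVariety.Points (AlgebraicClosure (w.adicCompletion F))) = 1 ↔ P ∈ K)
    {Bbar : AbelianSchemeOver (Spec (.of (geomResidueField w)))}
    (qbar : (sch₀Of 𝓜 w I.univ (red₀Of S Kc 𝓜 w h𝓨 e y)).X ⟶ Bbar.X)
    (hσΩ : (isoGenericOf I y).inv =
      (I.univ.fibreBaseChangeIso ((𝓜.localise w).genericIso'.inv.left ≫ pullback.fst (𝓜.localise w).total.hom (specGenericPoint (HeightOneSpectrum.valuationSubringAtPrime F w) F))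
          (thickeningLift e (S.M.obj Kc) y).left ≪≫
        I.univ.fibreCongrPtIso (left_thickeningLift_comp_genericι_eq S Kc 𝓜 w h𝓨 e y) ≪≫
        (I.univ.fibreBaseChangeIso (liftOf S Kc 𝓜 w h𝓨 e y).left (sΩ w)).symm).inv.hom.hom.hom)
    (hσκ : (isoSpecialOf I y).inv =
      (I.univ.fibreBaseChangeIso (pullback.fst (𝓜.localise w).total.hom (specResidueField w)) (red₀Of S Kc 𝓜 w h𝓨 e y).left ≪≫
        I.univ.fibreCongrPtIso (left_red₀Of_comp_specialι_eq S Kc 𝓜 w h𝓨 e y) ≪≫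
        (I.univ.fibreBaseChangeIso (liftOf S Kc 𝓜 w h𝓨 e y).left (sκ w)).symm).inv.hom.hom.hom)
    (hK3 : haveI : IsProper (𝓜.localise w).total.hom := h𝓨.2
      ∀ (𝒦 : Over (Spec (.of (closureValuationSubring (w.adicCompletion F))))) (incl : 𝒦 ⟶ (I.univ.baseChange (extendPoint (closureValuationSubring (w.adicCompletion F)) (toClosureValuationSubring w) (𝓜.localise w).total ((𝓜.localise w).modelPointsEquiv.symm (thickeningLift e (S.M.obj Kc) y))).left).X) [Flat 𝒦.hom],
        ((Over.pullback (specFractionFieldι (closureValuationSubring (w.adicCompletion F)) (toClosureValuationSubring w)).left).map incl ≫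
            (I.univ.fibreBaseChangeIso ((𝓜.localise w).genericIso'.inv.left ≫ pullback.fst (𝓜.localise w).total.hom (specGenericPoint (HeightOneSpectrum.valuationSubringAtPrime F w) F)) (thickeningLift e (S.M.obj Kc) y).left ≪≫ I.univ.fibreCongrPtIso ((𝓜.localise w).left_specFractionFieldι_comp_extendPoint_modelPointsEquiv_symm (thickeningLift e (S.M.obj Kc) y)).symm ≪≫ (I.univ.fibreBaseChangeIso (extendPoint (closureValuationSubring (w.adicCompletion F)) (toClosureValuationSubring w) (𝓜.localise w).total ((𝓜.localise w).modelPointsEquiv.symm (thickeningLift e (S.M.obj Kc) y))).left (specFractionFieldι (closureValuationSubring (w.adicCompletion F)) (toClosureValuationSubring w)).left).symm).inv.hom.hom.hom) ≫ q = 1 →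
        ((Over.pullback ((geomClosedPointIsoSpecResidueField w).inv.left ≫ (specRingHomι (closureValuationSubring (w.adicCompletion F)) (toClosureValuationSubring w) (IsLocalRing.residue (closureValuationSubring (w.adicCompletion F)))).left)).map incl ≫
            (I.univ.fibreBaseChangeIso (pullback.fst (𝓜.localise w).total.hom (specResidueField w)) ((𝓜.localise w).geomReductionMap (thickeningLift e (S.M.obj Kc) y)).left ≪≫ I.univ.fibreCongrPtIso (((𝓜.localise w).left_geomReductionMap_comp_fst (thickeningLift e (S.M.obj Kc) y)).trans (Category.assoc _ _ _).symm) ≪≫ (I.univ.fibreBaseChangeIso (extendPoint (closureValuationSubring (w.adicCompletion F)) (toClosureValuationSubring w) (𝓜.localise w).total ((𝓜.localise w).modelPointsEquiv.symm (thickeningLift e (S.M.obj Kc) y))).left ((geomClosedPointIsoSpecResidueField w).inv.left ≫ (specRingHomι (closureValuationSubring (w.adicCompletion F)) (toClosureValuationSubring w) (IsLocalRing.residue (closureValuationSubring (w.adicCompletion F)))).left)).symm).inv.hom.hom.hom) ≫ qbar = 1) :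
    ∃ (V : SchemeOver (geomResidueField w)) (ν : V ⟶ (sch₀Of 𝓜 w I.univ (red₀Of S Kc 𝓜 w h𝓨 e y)).X), IsClosedImmersion ν.left ∧
      (∀ ⦃T : SchemeOver (geomResidueField w)⦄ (t : T ⟶ (sch₀Of 𝓜 w I.univ (red₀Of S Kc 𝓜 w h𝓨 e y)).X), (∃ s : T ⟶ V, s ≫ ν = t) →
        (∀ r ∈ w.asIdeal, t ≫ (act₀Of 𝓜 w I.univ I.act r (red₀Of S Kc 𝓜 w h𝓨 e y)).hom.hom.hom = 1) ∧ t ≫ qbar = 1) ∧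
      I.pChar ^ I.fDeg ≤ Module.finrank (geomResidueField w) (Alg V) := by
  letI := (toGeomκ w).toAlgebra
  haveI := isMonHom_transRW I y
  haveI := isAffine_layerRW_left I y
  haveI := isAffine_layerκW_left I y
  haveI := isAffine_layerΩW_left I y
  haveI := isMonHom_isoSpecialOf_hom I y
  -- the kill by `q̄` on the model side (§W4) and on `V(spIW)` ((CLw-2))
  have hmodel := pullback_map_closureW_inv_comp_eq_one_of_kerRow I y Hw q K hHK r1 qbar hσΩ hσκ hK3
  have hkill := quotIncl_spIWOf_comp_eq_one_of_pullback_map I y Hw qbar hmodel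
  -- closedness of `ν := quotIncl ≫ (ιRW)_κ̄ ≫ σκ⁻¹`
  haveI := isClosedImmersion_quotIncl_left (layerκW I y) (spIWOf I y Hw)
  haveI := isClosedImmersion_pullback_map_ιRW_left I y
  haveI : IsIso (isoSpecialOf I y).inv.left := inferInstanceAs (IsIso ((Over.forget _).map (isoSpecialOf I y).inv))
  refine ⟨specOver (geomResidueField w) (Alg (layerκW I y) ⧸ spIWOf I y Hw),
    quotIncl (layerκW I y) (spIWOf I y Hw) ≫ (Over.pullback (sκ w)).map (ιRW I y) ≫ (isoSpecialOf I y).inv, ?_, ?_, ?_⟩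
  · rw [Over.comp_left, Over.comp_left]
    infer_instance
  · rintro T t ⟨s, rfl⟩
    refine ⟨fun r hr => ?_, ?_⟩
    · -- `σκ⁻¹ ≫ ι(r)_{x̄} = ι(r)_{sκ} ≫ σκ⁻¹` and `(ιRW)_κ̄ ≫ ι(r)_{sκ} = 1`
      have hσ : (isoSpecialOf I y).inv ≫ (act₀Of 𝓜 w I.univ I.act r (red₀Of S Kc 𝓜 w h𝓨 e y)).hom.hom.hom =
          ((actFamOf I y).baseChange (sκ w)).i r ≫ (isoSpecialOf I y).inv := by
        change (isoSpecialOf I y).inv ≫ ((I.act.baseChange (pullback.fst (𝓜.localise w).total.hom (specResidueField w))).baseChange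
            (red₀Of S Kc 𝓜 w h𝓨 e y).left).i r = _  -- was `rw [act₀Of_hom_hom_hom_eq]` (`rfl` law; ★ twin needs `[IsGalois ℚ F]`)
        rw [Iso.inv_comp_eq, ← Category.assoc, Iso.eq_comp_inv]
        exact act₀_i_comp_isoSpecialOf_hom I y r
      have hι := pullback_map_ιRW_comp_i_eq_one I y hr
      simp only [Category.assoc]
      rw [hσ, reassoc_of% hι, MonObj.one_comp, MonObj.comp_one, MonObj.comp_one]
    · have h := congrArg (fun φ => s ≫ φ) hkill
      simpa only [Category.assoc, MonObj.comp_one] using h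
  · rw [Literature.AlgebraicGeometry.GroupSchemes.FrobKillEt.finrank_alg_specOver_quotient (layerκW I y) (spIWOf I y Hw)]
    exact (isAdm_spIWOf I y Hw).2.1.ge

/-! ### §W6 the packaging `H_w := K ∩ A_y[𝔭_w]` as a `LineWOf` -/

open scoped MonObj CategoryTheory.Obj in
/-- **`infTorsionW I y K := K ∩ A_y[𝔭_w](Ω̄)`** as a subgroup: `K ⊓ ⨅_{a ∈ 𝔭_w} Ker (· ≫ ι(a))` (Mathlib `IsMonHom.monoidHom`, `MonoidHom.ker`). [cite: Liu2021, Prop. D.8 p. 135] -/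
def infTorsionW (y : AlgPoints (S.M.obj Kc) (AlgebraicClosure (w.adicCompletion F)))
    (K : Subgroup ((fibreΩOf S Kc 𝓜 w e I.univ y).Points (AlgebraicClosure (w.adicCompletion F)))) :
    Subgroup ((fibreΩOf S Kc 𝓜 w e I.univ y).Points (AlgebraicClosure (w.adicCompletion F))) :=
  K ⊓ ⨅ a : w.asIdeal, (IsMonHom.monoidHom (actΩOf S Kc 𝓜 w e I.univ I.act (a : 𝓞 F) y).hom.hom.hom
    (specOver (AlgebraicClosure (w.adicCompletion F)) (AlgebraicClosure (w.adicCompletion F)))).ker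

open scoped MonObj CategoryTheory.Obj in
/-- Membership in `infTorsionW`: `P ∈ K ∧ 𝔭_w · P = 1` (LA2-p03's subtype currency `{P // P ∈ K ∧ IsIdealTorsionΩ … w.asIdeal P}`). [cite: Liu2021, Prop. D.8 p. 135] -/
theorem mem_infTorsionW_iff (y : AlgPoints (S.M.obj Kc) (AlgebraicClosure (w.adicCompletion F)))
    (K : Subgroup ((fibreΩOf S Kc 𝓜 w e I.univ y).Points (AlgebraicClosure (w.adicCompletion F))))
    (P : (fibreΩOf S Kc 𝓜 w e I.univ y).Points (AlgebraicClosure (w.adicCompletion F))) :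
    P ∈ infTorsionW I y K ↔ P ∈ K ∧ IsIdealTorsionΩ S Kc 𝓜 w e I.univ I.act y w.asIdeal P := by
  simp only [infTorsionW, Subgroup.mem_inf, Subgroup.mem_iInf, IsIdealTorsionΩ, Subtype.forall]
  exact Iff.rfl

open scoped MonObj CategoryTheory.Obj in
/-- **`lineWOfKernel` — `H_w := K ∩ A_y[𝔭_w]` AS A `w`-LINE**, given that `K` is `𝒪_F`-stable (★ `roofKernel_stable` ∕ `map_i_mem_of_roof` for a roof kernel) and the COUNT
`#(K ∩ A_y[𝔭_w]) = p^f` in LA2-p03 (g3)'s subtype currency (his v3 `natCard_roofKernel_inf_idealTorsionΩ_w_eq`): torsion by definition, stability because the `ι(a)` commute.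
[cite: Liu2021, Prop. D.8 p. 135] [cite: Kottwitz1992, §5, p. 390] -/
def lineWOfKernel (y : AlgPoints (S.M.obj Kc) (AlgebraicClosure (w.adicCompletion F)))
    (K : Subgroup ((fibreΩOf S Kc 𝓜 w e I.univ y).Points (AlgebraicClosure (w.adicCompletion F))))
    (hstab : ∀ (a : 𝓞 F), ∀ P ∈ K, (AlgPoints.map (actΩOf S Kc 𝓜 w e I.univ I.act a y).hom.hom.hom P :
      (fibreΩOf S Kc 𝓜 w e I.univ y).Points (AlgebraicClosure (w.adicCompletion F))) ∈ K)
    (hcard : Nat.card {P : (fibreΩOf S Kc 𝓜 w e I.univ y).Points (AlgebraicClosure (w.adicCompletion F)) //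
      P ∈ K ∧ IsIdealTorsionΩ S Kc 𝓜 w e I.univ I.act y w.asIdeal P} = I.pChar ^ I.fDeg) :
    LineWOf I y :=
  ⟨infTorsionW I y K, by
    refine ⟨?_, fun P hP => ((mem_infTorsionW_iff I y K P).1 hP).2, fun a P hP => ?_⟩
    · rw [← hcard]
      exact Nat.card_congr (Equiv.subtypeEquivRight fun P => mem_infTorsionW_iff I y K P)
    · obtain ⟨hK, htor⟩ := (mem_infTorsionW_iff I y K P).1 hP
      refine (mem_infTorsionW_iff I y K _).2 ⟨hstab a P hK, fun b hb => ?_⟩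
      have hcomm : (actΩOf S Kc 𝓜 w e I.univ I.act a y).hom.hom.hom ≫ (actΩOf S Kc 𝓜 w e I.univ I.act b y).hom.hom.hom =
          (actΩOf S Kc 𝓜 w e I.univ I.act b y).hom.hom.hom ≫ (actΩOf S Kc 𝓜 w e I.univ I.act a y).hom.hom.hom :=
        (((I.act.baseChange _).baseChange _).i_comm a b)
      have h1 := htor b hb
      simp only [AlgPoints.map] at h1 ⊢
      rw [Category.assoc, hcomm, ← Category.assoc, h1, MonObj.one_comp]⟩

open scoped MonObj CategoryTheory.Obj in
/-- `lineWOfKernel … ⊆ K` (the `hHK` input of §W1–§W5). [cite: Liu2021, Prop. D.8 p. 135] -/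
theorem lineWOfKernel_le (y : AlgPoints (S.M.obj Kc) (AlgebraicClosure (w.adicCompletion F)))
    (K : Subgroup ((fibreΩOf S Kc 𝓜 w e I.univ y).Points (AlgebraicClosure (w.adicCompletion F))))
    (hstab : ∀ (a : 𝓞 F), ∀ P ∈ K, (AlgPoints.map (actΩOf S Kc 𝓜 w e I.univ I.act a y).hom.hom.hom P :
      (fibreΩOf S Kc 𝓜 w e I.univ y).Points (AlgebraicClosure (w.adicCompletion F))) ∈ K)
    (hcard : Nat.card {P : (fibreΩOf S Kc 𝓜 w e I.univ y).Points (AlgebraicClosure (w.adicCompletion F)) //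
      P ∈ K ∧ IsIdealTorsionΩ S Kc 𝓜 w e I.univ I.act y w.asIdeal P} = I.pChar ^ I.fDeg) :
    ∀ P ∈ (lineWOfKernel I y K hstab hcard).1, P ∈ K :=
  fun P hP => ((mem_infTorsionW_iff I y K P).1 hP).1

/-- Membership in `lineWOfKernel`: `P ∈ H_w ↔ P ∈ K ∧ 𝔭_w · P = 1`. [cite: Liu2021, Prop. D.8 p. 135] -/
theorem mem_lineWOfKernel_iff (y : AlgPoints (S.M.obj Kc) (AlgebraicClosure (w.adicCompletion F)))
    (K : Subgroup ((fibreΩOf S Kc 𝓜 w e I.univ y).Points (AlgebraicClosure (w.adicCompletion F))))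
    (hstab : ∀ (a : 𝓞 F), ∀ P ∈ K, (AlgPoints.map (actΩOf S Kc 𝓜 w e I.univ I.act a y).hom.hom.hom P :
      (fibreΩOf S Kc 𝓜 w e I.univ y).Points (AlgebraicClosure (w.adicCompletion F))) ∈ K)
    (hcard : Nat.card {P : (fibreΩOf S Kc 𝓜 w e I.univ y).Points (AlgebraicClosure (w.adicCompletion F)) //
      P ∈ K ∧ IsIdealTorsionΩ S Kc 𝓜 w e I.univ I.act y w.asIdeal P} = I.pChar ^ I.fDeg)
    (P : (fibreΩOf S Kc 𝓜 w e I.univ y).Points (AlgebraicClosure (w.adicCompletion F))) :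
    P ∈ (lineWOfKernel I y K hstab hcard).1 ↔ P ∈ K ∧ IsIdealTorsionΩ S Kc 𝓜 w e I.univ I.act y w.asIdeal P :=
  mem_infTorsionW_iff I y K P

end KillEngineW

end Summit.HodgeConjecture.HodgeConjecture.Cruxes.HLiu418.F0P6aLineSpecialisation

end
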